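import Summits.QuantumFields.BalabanUV.Beta.GAN24.DirichletBoxTwoLevelCore

/-!
# `BalabanUV.Beta.GAN24.DirichletBoxWeightedTraces` — binder row G-an2-4 / (CONV-C), road P2 PART IV, leaf T-W: THE SUMMED DISCRETE TRACE
# BOUNDS WITH VARIABLE RAY LENGTHS AND WEIGHTS on a block region (unit b2b-balaban-gan24-p2, gen 24, v1)

HONEST FRAMING (cell contract, verbatim): «discharging `BetaPertH` makes Bałaban's UV stability UNCONDITIONAL — a real constructive-QFT
result; it is NOT the continuum limit and NOT the Clay problem.»  Module M-T (`DirichletBoxTrace`/`DirichletBoxTraceSum`, PART II) bounds the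
boundary flux `Σ_{bdry}‖n·z‖²` of a field `z ⊂ Ω = blockReg n S` by `(2/n)(‖∂_μz‖² + Σ_{x∈Ω}|P_μz|²)`, reading each boundary value off the
inward ray of FIXED length `n`.  For the weighted socket (M-W `DirichletBoxWeightedSockets`, p234489) the flux binders (Φ), (Φ′) must be
reduced to WEIGHTED one-level quantities; this needs rays of VARIABLE length `ℓ(y) ≤ n` (short near a re-entrant edge, long far from it).
This file proves the generic statement: for any length function `1 ≤ ℓ ≤ n` and any nonnegative weights `ρ₁, ρ₂` dominating the ray
coefficients `2/ℓ(y)` (on the `∂`-terms) and `2ℓ(y)/n²` (on the `P`-terms) along each ray («ray schedule»),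
 * §1 `trace_sq_le_fwd_len` / `trace_sq_le_bwd_len` — pointwise, length `ℓ`: `|∂z(y∓…)|² ≤ (2/ℓ)Σ_{j<ℓ}|∂z|² + (2ℓ/n²)Σ_{i<ℓ−1}|P z|²`
   (M-T `tele_sq_le` with `n ↦ ℓ`, `p ↦ (ℓ/n)·P z`);
 * §2 **`trace_fwd_sum_le_weighted`** / **`trace_bwd_sum_le_weighted`**: `Σ_{y∈Ω, y∓e∉Ω}‖n·z(y)‖² ≤ Σ_x ρ₁(x)|(∂_μz)(x)|² + Σ_{x∈Ω} ρ₂(x)|(P_μz)(x)|²`;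
 * §3 **`nsq_bdryPart_le_weighted`**: the coarse flux binder (Φ) of the weighted socket, `nsq(bdryPart(∂_μu)) ≤` (fwd + bwd weighted sums).
With `ρ₁ = (12/n)·r⁻¹`, `ρ₂ = (2/n)·r`, `ℓ = ⌊r·n/2⌋` (r = distance to the re-entrant set) the schedule holds and (Φ) ≤ (12/n)(B) + (2/n)(A)
(memo `HOME/b2b-balaban-gan24-p2/gen24/W-FULL-WEIGHTED.md` §1 T-W) — the schedule check for a concrete `r` is the supplier's.

ABSOLUTE RULE (cell, verbatim): «No internally-minted statement may enter as a cited fact. Every hypothesis is either kernel-proved in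
this package or a verbatim quotation of a PUBLISHED theorem with page reference. The manuscript(s) under audit are NOT citable for
their own disputed steps — they are the thing under adjudication; programme-internal (2001/route/tribunal) claims are never citable.»
[folklore] finite lattice calculus; nothing printed is a hypothesis.  NOT CLAIMED: the weighted estimates (A)/(B), NE2, (CONV-C) as a whole,
`BetaPertH`, continuum, Clay.  «not in print; our proof attempt».  HONEST DEPENDENCY: continuum YM on T⁴ ⇐ BetaPertH ∧ nine spine
estimates (0/9 proved); BetaPertH ⇐ (D1) ∧ (D4) ∧ CAP+tail; G-an2-4 gates asym, D1 and NE2/3/4.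
-/

noncomputable section

open scoped BigOperators ComplexConjugate Matrix
open Finset

namespace Summit.QuantumFields.BalabanUV.Beta.GAN24.DirichletBoxWeightedTraces

open Literature.MathematicalPhysics.QuantumFieldTheory.Balaban1983to89.B5Prop11Plancherel (Tor fine unitVec)
open Literature.MathematicalPhysics.QuantumFieldTheory.Balaban1983to89.B5Action121 (sdiff sdiff_mulVec)
open Literature.MathematicalPhysics.QuantumFieldTheory.Balaban1983to89.B5Prop11Lower (nsq nsq_nonneg)
open Literature.MathematicalPhysics.QuantumFieldTheory.Balaban1983to89.B5Block118 (tstep tstep_zero tstep_succ)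
open Summit.QuantumFields.BalabanUV.Beta.GAN24.DirichletBoxRegularity (Pdir Pdir_mulVec)
open Summit.QuantumFields.BalabanUV.T4Continuum.VectorBlockTrialForm (tstep_add)
open Summit.QuantumFields.BalabanUV.Beta.GAN24.DirichletBoxTrace
open Summit.QuantumFields.BalabanUV.Beta.GAN24.DirichletBoxTwoLevelCore (bdryPart)

variable {d : ℕ} (n : ℕ) [NeZero n] (M : Fin d → ℕ) [hM : ∀ μ, NeZero (M μ)]

/-! ## §1 Pointwise trace inequalities with a variable ray length -/

/-- **POINTWISE TRACE INEQUALITY, forward, length `ℓ`**: for every `z`, `y`, `μ` and `1 ≤ ℓ`,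
`‖(∂_μz)(y − e_μ)‖² ≤ (2/ℓ)·Σ_{j<ℓ}‖(∂_μz)(y − e_μ + j e_μ)‖² + (2ℓ/n²)·Σ_{i<ℓ−1}‖(∂_μᴴ∂_μz)(y + i e_μ)‖²`. [folklore] -/
theorem trace_sq_le_fwd_len {ℓ : ℕ} (hℓ : 1 ≤ ℓ) (μ : Fin d) (z : Tor (fine n M) → ℂ) (y : Tor (fine n M)) :
    ‖(sdiff (fine n M) (n : ℂ) μ *ᵥ z) (y - unitVec (fine n M) μ)‖ ^ 2
      ≤ (2 / (ℓ : ℝ)) * ∑ j ∈ range ℓ, ‖(sdiff (fine n M) (n : ℂ) μ *ᵥ z) (y - unitVec (fine n M) μ + tstep (fine n M) μ j)‖ ^ 2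
        + (2 * (ℓ : ℝ) / (n : ℝ) ^ 2) * ∑ i ∈ range (ℓ - 1), ‖(Pdir (fine n M) (n : ℂ) μ *ᵥ z) (y + tstep (fine n M) μ i)‖ ^ 2 := by
  have hn : (0 : ℝ) < n := by exact_mod_cast Nat.pos_of_ne_zero (NeZero.ne n)
  have hnC : (n : ℂ) ≠ 0 := by exact_mod_cast NeZero.ne n
  have hℓR : (0 : ℝ) < ℓ := by exact_mod_cast hℓ
  have h := tele_sq_le hℓ (fun j => (sdiff (fine n M) (n : ℂ) μ *ᵥ z) (y - unitVec (fine n M) μ + tstep (fine n M) μ j))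
    (fun i => ((ℓ : ℂ) / (n : ℂ)) * (Pdir (fine n M) (n : ℂ) μ *ᵥ z) (y + tstep (fine n M) μ i)) (fun i _ => by
      have e1 : y - unitVec (fine n M) μ + tstep (fine n M) μ (i + 1) = y + tstep (fine n M) μ i := by
        rw [tstep_succ]; abel
      have e2 : y - unitVec (fine n M) μ + tstep (fine n M) μ i = (y + tstep (fine n M) μ i) - unitVec (fine n M) μ := by abel
      rw [e1, e2, sdiff_sub_sdiff_eq, norm_div, norm_neg, Complex.norm_natCast, norm_mul, norm_div, Complex.norm_natCast,
        Complex.norm_natCast]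
      apply le_of_eq
      field_simp)
  simp only [tstep_zero, add_zero] at h
  refine h.trans (le_of_eq ?_)
  rw [mul_add, Finset.mul_sum, Finset.mul_sum, Finset.mul_sum]
  congr 1
  refine Finset.sum_congr rfl fun i _ => ?_
  rw [norm_mul, norm_div, Complex.norm_natCast, Complex.norm_natCast, mul_pow, div_pow]
  field_simp

/-- **POINTWISE TRACE INEQUALITY, backward, length `ℓ`**: for every `z`, `y`, `μ` and `1 ≤ ℓ`,
`‖(∂_μz)(y)‖² ≤ (2/ℓ)·Σ_{j<ℓ}‖(∂_μz)(y − j e_μ)‖² + (2ℓ/n²)·Σ_{i<ℓ−1}‖(∂_μᴴ∂_μz)(y − i e_μ)‖²`. [folklore] -/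
theorem trace_sq_le_bwd_len {ℓ : ℕ} (hℓ : 1 ≤ ℓ) (μ : Fin d) (z : Tor (fine n M) → ℂ) (y : Tor (fine n M)) :
    ‖(sdiff (fine n M) (n : ℂ) μ *ᵥ z) y‖ ^ 2
      ≤ (2 / (ℓ : ℝ)) * ∑ j ∈ range ℓ, ‖(sdiff (fine n M) (n : ℂ) μ *ᵥ z) (y - tstep (fine n M) μ j)‖ ^ 2
        + (2 * (ℓ : ℝ) / (n : ℝ) ^ 2) * ∑ i ∈ range (ℓ - 1), ‖(Pdir (fine n M) (n : ℂ) μ *ᵥ z) (y - tstep (fine n M) μ i)‖ ^ 2 := by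
  have hn : (0 : ℝ) < n := by exact_mod_cast Nat.pos_of_ne_zero (NeZero.ne n)
  have hnC : (n : ℂ) ≠ 0 := by exact_mod_cast NeZero.ne n
  have hℓR : (0 : ℝ) < ℓ := by exact_mod_cast hℓ
  have h := tele_sq_le hℓ (fun j => (sdiff (fine n M) (n : ℂ) μ *ᵥ z) (y - tstep (fine n M) μ j))
    (fun i => ((ℓ : ℂ) / (n : ℂ)) * (Pdir (fine n M) (n : ℂ) μ *ᵥ z) (y - tstep (fine n M) μ i)) (fun i _ => by
      have e1 : y - tstep (fine n M) μ (i + 1) = (y - tstep (fine n M) μ i) - unitVec (fine n M) μ := by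
        rw [tstep_succ]; abel
      rw [e1, ← neg_sub, norm_neg, sdiff_sub_sdiff_eq, norm_div, norm_neg, Complex.norm_natCast, norm_mul, norm_div,
        Complex.norm_natCast, Complex.norm_natCast]
      apply le_of_eq
      field_simp)
  simp only [tstep_zero, sub_zero] at h
  refine h.trans (le_of_eq ?_)
  rw [mul_add, Finset.mul_sum, Finset.mul_sum, Finset.mul_sum]
  congr 1
  refine Finset.sum_congr rfl fun i _ => ?_
  rw [norm_mul, norm_div, Complex.norm_natCast, Complex.norm_natCast, mul_pow, div_pow]
  field_simp

/-! ## §2 The summed weighted trace bounds on a block region -/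

section Sum

variable (S : Tor M → Prop) [DecidablePred S]

/-- **SUMMED WEIGHTED TRACE BOUND, forward boundary**: for `z` vanishing off `Ω = blockReg n S`, a ray-length function `1 ≤ ℓ ≤ n` and
weights `ρ₁, ρ₂ ≥ 0` with the RAY SCHEDULE `2/ℓ(y) ≤ ρ₁(y − e_μ + j e_μ)` (`j < ℓ(y)`) and `2ℓ(y)/n² ≤ ρ₂(y + i e_μ)` (`i + 1 < ℓ(y)`) at every
forward boundary site `y` (`y ∈ Ω`, `y − e_μ ∉ Ω`):
`Σ_{y∈Ω, y−e_μ∉Ω} ‖n·z(y)‖² ≤ Σ_x ρ₁(x)‖(∂_μz)(x)‖² + Σ_{x∈Ω} ρ₂(x)‖(∂_μᴴ∂_μz)(x)‖²`. [folklore] -/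
theorem trace_fwd_sum_le_weighted (μ : Fin d) (z : Tor (fine n M) → ℂ) (hz : ∀ x, ¬ blockReg n M S x → z x = 0)
    (ℓ : Tor (fine n M) → ℕ) (hℓ1 : ∀ y, 1 ≤ ℓ y) (hℓn : ∀ y, ℓ y ≤ n)
    (ρ₁ ρ₂ : Tor (fine n M) → ℝ) (hρ₁ : ∀ x, 0 ≤ ρ₁ x) (hρ₂ : ∀ x, 0 ≤ ρ₂ x)
    (h₁ : ∀ y, blockReg n M S y → ¬ blockReg n M S (y - unitVec (fine n M) μ) →
      ∀ j, j < ℓ y → 2 / (ℓ y : ℝ) ≤ ρ₁ (y - unitVec (fine n M) μ + tstep (fine n M) μ j))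
    (h₂ : ∀ y, blockReg n M S y → ¬ blockReg n M S (y - unitVec (fine n M) μ) →
      ∀ i, i + 1 < ℓ y → 2 * (ℓ y : ℝ) / (n : ℝ) ^ 2 ≤ ρ₂ (y + tstep (fine n M) μ i)) :
    ∑ y ∈ univ.filter (fun y : Tor (fine n M) => blockReg n M S y ∧ ¬ blockReg n M S (y - unitVec (fine n M) μ)),
        ‖(n : ℂ) * z y‖ ^ 2
      ≤ ∑ x, ρ₁ x * ‖(sdiff (fine n M) (n : ℂ) μ *ᵥ z) x‖ ^ 2
          + ∑ x ∈ univ.filter (blockReg n M S), ρ₂ x * ‖(Pdir (fine n M) (n : ℂ) μ *ᵥ z) x‖ ^ 2 := by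
  have hn1 : 1 ≤ n := Nat.pos_of_ne_zero (NeZero.ne n)
  set D := sdiff (fine n M) (n : ℂ) μ with hD
  set P := Pdir (fine n M) (n : ℂ) μ with hP
  set e := unitVec (fine n M) μ with he
  -- the density `H = ρ₁(· − e)|∂z(· − e)|² + 𝟙_Ω ρ₂ |Pz|²`
  set G : Tor (fine n M) → ℝ := fun x => if blockReg n M S x then ρ₂ x * ‖(P *ᵥ z) x‖ ^ 2 else 0 with hG
  have hG0 : ∀ x, 0 ≤ G x := fun x => by
    simp only [hG]; split_ifs
    · exact mul_nonneg (hρ₂ x) (sq_nonneg _)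
    · exact le_rfl
  set H : Tor (fine n M) → ℝ := fun x => ρ₁ (x - e) * ‖(D *ᵥ z) (x - e)‖ ^ 2 + G x with hH
  have hH0 : ∀ x, 0 ≤ H x := fun x => by
    simp only [hH]; exact add_nonneg (mul_nonneg (hρ₁ _) (sq_nonneg _)) (hG0 x)
  set B := univ.filter (fun y : Tor (fine n M) => blockReg n M S y ∧ ¬ blockReg n M S (y - e)) with hBdef
  -- pointwise bound at a forward boundary point
  have hpt : ∀ y ∈ B, ‖(n : ℂ) * z y‖ ^ 2 ≤ ∑ i ∈ range n, H (y + tstep (fine n M) μ i) := by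
    intro y hy
    obtain ⟨hy1, hy2⟩ := (Finset.mem_filter.mp hy).2
    have hval : (D *ᵥ z) (y - e) = (n : ℂ) * z y := by
      rw [hD, sdiff_mulVec, he, sub_add_cancel, hz _ hy2, sub_zero]
    rw [← hval]
    have hdvd := dvd_of_boundary_fwd n M S hy1 hy2
    refine (trace_sq_le_fwd_len n M (hℓ1 y) μ z y).trans ?_
    -- absorb the coefficients into the weights along the ray, then extend the ray to length `n`
    have hA : (2 / (ℓ y : ℝ)) * ∑ j ∈ range (ℓ y), ‖(D *ᵥ z) (y - e + tstep (fine n M) μ j)‖ ^ 2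
        ≤ ∑ j ∈ range n, ρ₁ (y + tstep (fine n M) μ j - e) * ‖(D *ᵥ z) (y + tstep (fine n M) μ j - e)‖ ^ 2 := by
      rw [Finset.mul_sum]
      refine le_trans (Finset.sum_le_sum fun j hj => ?_)
        (Finset.sum_le_sum_of_subset_of_nonneg (Finset.range_subset_range.mpr (hℓn y))
          (fun j _ _ => mul_nonneg (hρ₁ _) (sq_nonneg _)))
      have hj' := Finset.mem_range.mp hj
      have e1 : y + tstep (fine n M) μ j - e = y - e + tstep (fine n M) μ j := by abel
      rw [e1]
      exact mul_le_mul_of_nonneg_right (h₁ y hy1 hy2 j hj') (sq_nonneg _)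
    have hB' : (2 * (ℓ y : ℝ) / (n : ℝ) ^ 2) * ∑ i ∈ range (ℓ y - 1), ‖(P *ᵥ z) (y + tstep (fine n M) μ i)‖ ^ 2
        ≤ ∑ i ∈ range n, G (y + tstep (fine n M) μ i) := by
      rw [Finset.mul_sum]
      refine le_trans (Finset.sum_le_sum fun i hi => ?_)
        (Finset.sum_le_sum_of_subset_of_nonneg (Finset.range_subset_range.mpr (by have := hℓn y; omega))
          (fun i _ _ => hG0 _))
      have hi' : i + 1 < ℓ y := by have := Finset.mem_range.mp hi; omega
      have hin : i < n := by have := hℓn y; omega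
      simp only [hG, if_pos (blockReg_add_tstep n M S hy1 hdvd hin)]
      exact mul_le_mul_of_nonneg_right (h₂ y hy1 hy2 i hi') (sq_nonneg _)
    calc _ ≤ _ := add_le_add hA hB'
      _ = ∑ i ∈ range n, H (y + tstep (fine n M) μ i) := by rw [hH]; simp only [Finset.sum_add_distrib]
  have hsub : B ⊆ univ.filter (fun y : Tor (fine n M) => n ∣ (y μ).val) := by
    intro y hy
    obtain ⟨hy1, hy2⟩ := (Finset.mem_filter.mp hy).2
    exact Finset.mem_filter.mpr ⟨Finset.mem_univ _, dvd_of_boundary_fwd n M S hy1 hy2⟩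
  have htot : ∑ x, H x = ∑ x, ρ₁ x * ‖(D *ᵥ z) x‖ ^ 2 + ∑ x ∈ univ.filter (blockReg n M S), ρ₂ x * ‖(P *ᵥ z) x‖ ^ 2 := by
    rw [hH]
    simp only [Finset.sum_add_distrib]
    congr 1
    · exact Fintype.sum_equiv (Equiv.subRight e) _ _ (fun _ => rfl)
    · rw [Finset.sum_filter]
  calc ∑ y ∈ B, ‖(n : ℂ) * z y‖ ^ 2 ≤ ∑ y ∈ B, ∑ i ∈ range n, H (y + tstep (fine n M) μ i) := Finset.sum_le_sum hpt
    _ ≤ ∑ x, H x := sum_lines_le_of_subset n M μ hsub hH0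
    _ = _ := htot

/-- **SUMMED WEIGHTED TRACE BOUND, backward boundary**: for `z` vanishing off `Ω = blockReg n S`, a ray-length function `1 ≤ ℓ ≤ n` and
weights `ρ₁, ρ₂ ≥ 0` with the RAY SCHEDULE `2/ℓ(y) ≤ ρ₁(y − j e_μ)` (`j < ℓ(y)`) and `2ℓ(y)/n² ≤ ρ₂(y − i e_μ)` (`i + 1 < ℓ(y)`) at every
backward boundary site `y` (`y ∈ Ω`, `y + e_μ ∉ Ω`):
`Σ_{y∈Ω, y+e_μ∉Ω} ‖n·z(y)‖² ≤ Σ_x ρ₁(x)‖(∂_μz)(x)‖² + Σ_{x∈Ω} ρ₂(x)‖(∂_μᴴ∂_μz)(x)‖²`. [folklore] -/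
theorem trace_bwd_sum_le_weighted (μ : Fin d) (z : Tor (fine n M) → ℂ) (hz : ∀ x, ¬ blockReg n M S x → z x = 0)
    (ℓ : Tor (fine n M) → ℕ) (hℓ1 : ∀ y, 1 ≤ ℓ y) (hℓn : ∀ y, ℓ y ≤ n)
    (ρ₁ ρ₂ : Tor (fine n M) → ℝ) (hρ₁ : ∀ x, 0 ≤ ρ₁ x) (hρ₂ : ∀ x, 0 ≤ ρ₂ x)
    (h₁ : ∀ y, blockReg n M S y → ¬ blockReg n M S (y + unitVec (fine n M) μ) →
      ∀ j, j < ℓ y → 2 / (ℓ y : ℝ) ≤ ρ₁ (y - tstep (fine n M) μ j))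
    (h₂ : ∀ y, blockReg n M S y → ¬ blockReg n M S (y + unitVec (fine n M) μ) →
      ∀ i, i + 1 < ℓ y → 2 * (ℓ y : ℝ) / (n : ℝ) ^ 2 ≤ ρ₂ (y - tstep (fine n M) μ i)) :
    ∑ y ∈ univ.filter (fun y : Tor (fine n M) => blockReg n M S y ∧ ¬ blockReg n M S (y + unitVec (fine n M) μ)),
        ‖(n : ℂ) * z y‖ ^ 2
      ≤ ∑ x, ρ₁ x * ‖(sdiff (fine n M) (n : ℂ) μ *ᵥ z) x‖ ^ 2
          + ∑ x ∈ univ.filter (blockReg n M S), ρ₂ x * ‖(Pdir (fine n M) (n : ℂ) μ *ᵥ z) x‖ ^ 2 := by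
  have hn1 : 1 ≤ n := Nat.pos_of_ne_zero (NeZero.ne n)
  set D := sdiff (fine n M) (n : ℂ) μ with hD
  set P := Pdir (fine n M) (n : ℂ) μ with hP
  set e := unitVec (fine n M) μ with he
  set G : Tor (fine n M) → ℝ := fun x => if blockReg n M S x then ρ₂ x * ‖(P *ᵥ z) x‖ ^ 2 else 0 with hG
  have hG0 : ∀ x, 0 ≤ G x := fun x => by
    simp only [hG]; split_ifs
    · exact mul_nonneg (hρ₂ x) (sq_nonneg _)
    · exact le_rfl
  set H : Tor (fine n M) → ℝ := fun x => ρ₁ x * ‖(D *ᵥ z) x‖ ^ 2 + G x with hH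
  have hH0 : ∀ x, 0 ≤ H x := fun x => by
    simp only [hH]; exact add_nonneg (mul_nonneg (hρ₁ _) (sq_nonneg _)) (hG0 x)
  set c := tstep (fine n M) μ (n - 1) with hc
  set B := univ.filter (fun y : Tor (fine n M) => blockReg n M S y ∧ ¬ blockReg n M S (y + e)) with hBdef
  have hpt : ∀ y ∈ B, ‖(n : ℂ) * z y‖ ^ 2 ≤ ∑ i ∈ range n, H ((y - c) + tstep (fine n M) μ i) := by
    intro y hy
    obtain ⟨hy1, hy2⟩ := (Finset.mem_filter.mp hy).2
    have hval : ‖(D *ᵥ z) y‖ = ‖(n : ℂ) * z y‖ := by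
      rw [hD, sdiff_mulVec, ← he, hz _ hy2, zero_sub, mul_neg, norm_neg]
    rw [← hval]
    have hdvd := dvd_succ_of_boundary_bwd n M S hy1 hy2
    -- re-index `i ↦ n − 1 − i`
    have ere : ∀ i, i < n → y - tstep (fine n M) μ i = (y - c) + tstep (fine n M) μ (n - 1 - i) := by
      intro i hi
      rw [hc, sub_add, sub_right_inj, eq_sub_iff_add_eq, ← tstep_add]
      congr 1; omega
    have hreflect : ∀ (K : Tor (fine n M) → ℝ), ∑ i ∈ range n, K (y - tstep (fine n M) μ i)
        = ∑ i ∈ range n, K ((y - c) + tstep (fine n M) μ i) := by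
      intro K
      rw [← Finset.sum_range_reflect (fun i => K ((y - c) + tstep (fine n M) μ i)) n]
      refine Finset.sum_congr rfl fun i hi => ?_
      rw [ere i (Finset.mem_range.mp hi)]
    refine (trace_sq_le_bwd_len n M (hℓ1 y) μ z y).trans ?_
    have hA : (2 / (ℓ y : ℝ)) * ∑ j ∈ range (ℓ y), ‖(D *ᵥ z) (y - tstep (fine n M) μ j)‖ ^ 2
        ≤ ∑ j ∈ range n, ρ₁ (y - tstep (fine n M) μ j) * ‖(D *ᵥ z) (y - tstep (fine n M) μ j)‖ ^ 2 := by
      rw [Finset.mul_sum]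
      refine le_trans (Finset.sum_le_sum fun j hj => ?_)
        (Finset.sum_le_sum_of_subset_of_nonneg (Finset.range_subset_range.mpr (hℓn y))
          (fun j _ _ => mul_nonneg (hρ₁ _) (sq_nonneg _)))
      exact mul_le_mul_of_nonneg_right (h₁ y hy1 hy2 j (Finset.mem_range.mp hj)) (sq_nonneg _)
    have hB' : (2 * (ℓ y : ℝ) / (n : ℝ) ^ 2) * ∑ i ∈ range (ℓ y - 1), ‖(P *ᵥ z) (y - tstep (fine n M) μ i)‖ ^ 2
        ≤ ∑ i ∈ range n, G (y - tstep (fine n M) μ i) := by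
      rw [Finset.mul_sum]
      refine le_trans (Finset.sum_le_sum fun i hi => ?_)
        (Finset.sum_le_sum_of_subset_of_nonneg (Finset.range_subset_range.mpr (by have := hℓn y; omega))
          (fun i _ _ => hG0 _))
      have hi' : i + 1 < ℓ y := by have := Finset.mem_range.mp hi; omega
      have hin : i < n := by have := hℓn y; omega
      simp only [hG, if_pos (blockReg_sub_tstep n M S hy1 hdvd hin)]
      exact mul_le_mul_of_nonneg_right (h₂ y hy1 hy2 i hi') (sq_nonneg _)
    calc _ ≤ _ := add_le_add hA hB'
      _ = ∑ i ∈ range n, H (y - tstep (fine n M) μ i) := by rw [hH]; simp only [Finset.sum_add_distrib]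
      _ = ∑ i ∈ range n, H ((y - c) + tstep (fine n M) μ i) := hreflect H
  have himg : B.image (fun y => y - c) ⊆ univ.filter (fun y : Tor (fine n M) => n ∣ (y μ).val) := by
    intro y0 hy0
    obtain ⟨y, hy, rfl⟩ := Finset.mem_image.mp hy0
    obtain ⟨hy1, hy2⟩ := (Finset.mem_filter.mp hy).2
    exact Finset.mem_filter.mpr ⟨Finset.mem_univ _, (firstLayer_of_lastLayer n M (dvd_succ_of_boundary_bwd n M S hy1 hy2)).1⟩
  have htot : ∑ x, H x = ∑ x, ρ₁ x * ‖(D *ᵥ z) x‖ ^ 2 + ∑ x ∈ univ.filter (blockReg n M S), ρ₂ x * ‖(P *ᵥ z) x‖ ^ 2 := by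
    rw [hH]
    simp only [Finset.sum_add_distrib]
    congr 1
    rw [Finset.sum_filter]
  calc ∑ y ∈ B, ‖(n : ℂ) * z y‖ ^ 2 ≤ ∑ y ∈ B, ∑ i ∈ range n, H ((y - c) + tstep (fine n M) μ i) := Finset.sum_le_sum hpt
    _ = ∑ y0 ∈ B.image (fun y => y - c), ∑ i ∈ range n, H (y0 + tstep (fine n M) μ i) := by
        rw [Finset.sum_image (fun a _ b _ h => sub_left_injective h)]
    _ ≤ ∑ x, H x := sum_lines_le_of_subset n M μ himg hH0
    _ = _ := htot

/-! ## §3 The coarse flux binder (Φ) of the weighted socket -/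

/-- the boundary part of `∂_μu` splits into the forward and backward boundary fluxes:
`nsq(bdryPart(∂_μu)) ≤ Σ_{y∈Ω, y+e∉Ω}‖n·u(y)‖² + Σ_{y∈Ω, y−e∉Ω}‖n·u(y)‖²` (M-E file 1 §4, first two steps). [folklore] -/
theorem nsq_bdryPart_le_fluxes (μ : Fin d) {u : Tor (fine n M) → ℂ} (hu : ∀ y, ¬ blockReg n M S y → u y = 0) :
    nsq (bdryPart n M (blockReg n M S) μ (sdiff (fine n M) (n : ℂ) μ *ᵥ u))
      ≤ ∑ y ∈ univ.filter (fun y : Tor (fine n M) => blockReg n M S y ∧ ¬ blockReg n M S (y + unitVec (fine n M) μ)),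
            ‖(n : ℂ) * u y‖ ^ 2
        + ∑ y ∈ univ.filter (fun y : Tor (fine n M) => blockReg n M S y ∧ ¬ blockReg n M S (y - unitVec (fine n M) μ)),
            ‖(n : ℂ) * u y‖ ^ 2 := by
  set Ω := blockReg n M S with hΩ
  set e := unitVec (fine n M) μ with he
  set T : Tor (fine n M) → ℝ := fun y => ‖(n : ℂ) * u y‖ ^ 2 with hT
  have hpt : ∀ y, ‖bdryPart n M Ω μ (sdiff (fine n M) (n : ℂ) μ *ᵥ u) y‖ ^ 2
      ≤ (if (Ω y ∧ ¬ Ω (y + e)) then T y else 0) + (if (Ω (y + e) ∧ ¬ Ω y) then T (y + e) else 0) := by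
    intro y
    rw [bdryPart]
    by_cases h1 : Ω y <;> by_cases h2 : Ω (y + e)
    · simp [h1, h2, ← he]
    · rw [if_neg (by tauto), if_pos ⟨h1, h2⟩, if_neg (by tauto), add_zero, hT, sdiff_mulVec, ← he, hu _ h2, zero_sub, mul_neg,
        norm_neg]
    · rw [if_neg (by tauto), if_neg (by tauto), if_pos ⟨h2, h1⟩, zero_add, hT, sdiff_mulVec, ← he, hu _ h1, sub_zero]
    · simp [h1, h2, ← he]
  have hA : ∑ y, (if (Ω y ∧ ¬ Ω (y + e)) then T y else 0) = ∑ y ∈ univ.filter (fun y => Ω y ∧ ¬ Ω (y + e)), T y :=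
    (Finset.sum_filter _ _).symm
  have hB : ∑ y, (if (Ω (y + e) ∧ ¬ Ω y) then T (y + e) else 0) = ∑ y ∈ univ.filter (fun y => Ω y ∧ ¬ Ω (y - e)), T y := by
    rw [Finset.sum_filter]
    exact Fintype.sum_equiv (Equiv.addRight e) _ _ (fun y => by simp only [Equiv.coe_addRight, add_sub_cancel_right])
  calc nsq (bdryPart n M Ω μ (sdiff (fine n M) (n : ℂ) μ *ᵥ u))
      ≤ ∑ y, ((if (Ω y ∧ ¬ Ω (y + e)) then T y else 0) + (if (Ω (y + e) ∧ ¬ Ω y) then T (y + e) else 0)) :=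
        Finset.sum_le_sum fun y _ => hpt y
    _ = _ := by rw [Finset.sum_add_distrib, hA, hB]

/-- **THE COARSE FLUX BINDER (Φ) FROM WEIGHTED ONE-LEVEL QUANTITIES**: for `u` vanishing off `Ω = blockReg n S`, a ray-length function
`1 ≤ ℓ ≤ n` and weights `ρ₁, ρ₂ ≥ 0` satisfying BOTH ray schedules (forward and backward boundary sites) in direction `μ`,
`nsq(bdryPart(∂_μu)) ≤ 2·Σ_x ρ₁(x)‖(∂_μu)(x)‖² + 2·Σ_{x∈Ω} ρ₂(x)‖(∂_μᴴ∂_μu)(x)‖²`.  With `ρ₁ = (12/n)ω⁻¹`, `ρ₂ = (2/n)w` this is the (Φ)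
hypothesis of `DirichletBoxWeightedSockets.injected_le_of_weighted` in terms of (B) and (A). [folklore] -/
theorem nsq_bdryPart_le_weighted (μ : Fin d) {u : Tor (fine n M) → ℂ} (hu : ∀ y, ¬ blockReg n M S y → u y = 0)
    (ℓ : Tor (fine n M) → ℕ) (hℓ1 : ∀ y, 1 ≤ ℓ y) (hℓn : ∀ y, ℓ y ≤ n)
    (ρ₁ ρ₂ : Tor (fine n M) → ℝ) (hρ₁ : ∀ x, 0 ≤ ρ₁ x) (hρ₂ : ∀ x, 0 ≤ ρ₂ x)
    (hf₁ : ∀ y, blockReg n M S y → ¬ blockReg n M S (y - unitVec (fine n M) μ) →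
      ∀ j, j < ℓ y → 2 / (ℓ y : ℝ) ≤ ρ₁ (y - unitVec (fine n M) μ + tstep (fine n M) μ j))
    (hf₂ : ∀ y, blockReg n M S y → ¬ blockReg n M S (y - unitVec (fine n M) μ) →
      ∀ i, i + 1 < ℓ y → 2 * (ℓ y : ℝ) / (n : ℝ) ^ 2 ≤ ρ₂ (y + tstep (fine n M) μ i))
    (hb₁ : ∀ y, blockReg n M S y → ¬ blockReg n M S (y + unitVec (fine n M) μ) →
      ∀ j, j < ℓ y → 2 / (ℓ y : ℝ) ≤ ρ₁ (y - tstep (fine n M) μ j))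
    (hb₂ : ∀ y, blockReg n M S y → ¬ blockReg n M S (y + unitVec (fine n M) μ) →
      ∀ i, i + 1 < ℓ y → 2 * (ℓ y : ℝ) / (n : ℝ) ^ 2 ≤ ρ₂ (y - tstep (fine n M) μ i)) :
    nsq (bdryPart n M (blockReg n M S) μ (sdiff (fine n M) (n : ℂ) μ *ᵥ u))
      ≤ 2 * ∑ x, ρ₁ x * ‖(sdiff (fine n M) (n : ℂ) μ *ᵥ u) x‖ ^ 2
          + 2 * ∑ x ∈ univ.filter (blockReg n M S), ρ₂ x * ‖(Pdir (fine n M) (n : ℂ) μ *ᵥ u) x‖ ^ 2 := by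
  have h0 := nsq_bdryPart_le_fluxes n M S μ hu
  have hf := trace_fwd_sum_le_weighted n M S μ u hu ℓ hℓ1 hℓn ρ₁ ρ₂ hρ₁ hρ₂ hf₁ hf₂
  have hb := trace_bwd_sum_le_weighted n M S μ u hu ℓ hℓ1 hℓn ρ₁ ρ₂ hρ₁ hρ₂ hb₁ hb₂
  linarith

end Sum

end Summit.QuantumFields.BalabanUV.Beta.GAN24.DirichletBoxWeightedTraces

end
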